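import Literature.NumberTheory.LFunctions.SelbergArgOmegaKernel
import HarnessLib

/-!
# The explicit formula for the window `[u, u+h]`: `∫_u^{u+h}` of the Guinand–Weil formula for `h_{τ,t}`

Topic `Literature/NumberTheory/LFunctions`. Everything in this file is PROVED (no definitions, no
named facts).

For Selberg's and Fujii's `L¹` theory of `S(t+h) − S(t)` (Titchmarsh §9.26) one needs the
explicit formula for a test function whose transform on the critical line is the *window*
`∫_u^{u+h} K_τ(γ − t) dt` around the heights `[u, u+h]`. Rather than building that test function,
we integrate the tree's explicit formula for the twisted dilate `h_{τ,t}(y) = g_τ(y) e^{-ity}`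
(`Literature.NumberTheory.LFunctions.SelbergOmega.explicit_formula_testFn`) over `t ∈ [u, u+h]`:
the zero side is summed under the integral sign (dominated by `m(ρ)/(1+γ²)²`,
`Literature.NumberTheory.LFunctions.weilZeroSummable`), each zero contributes
`∫_u^{u+h} K_τ(γ − t) dt + 𝒜_ρ(u+h) − 𝒜_ρ(u)` (Tsang's antiderivative,
`Literature.NumberTheory.LFunctions.SelbergOmega.integral_weilMellin_sub_kerDil`), and the prime term
integrates to the trigonometric polynomial `𝒱_τ(u+h) − 𝒱_τ(u)`
(`Literature.NumberTheory.LFunctions.SelbergOmega.integral_primeTerm`).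

* `Literature.NumberTheory.LFunctions.SelbergDelta.integrated_explicit_formula` — the identity.

## References

* E. C. Titchmarsh, *The Theory of the Riemann Zeta-Function*, 2nd ed. (1986), §9.26.
  [cite: Titchmarsh1986, §9.26]
* A. Selberg, *Contributions to the theory of the Riemann zeta-function* (1946), §§5–7.
* K.-M. Tsang, *Some Ω-theorems for the Riemann zeta-function*, Acta Arith. 46 (1986), Lemma 5.
-/

noncomputable section

open Complex Real MeasureTheory Set Filter intervalIntegral
open scoped Topology ENNReal

namespace Literature.NumberTheory.LFunctions.SelbergDelta

open Literature.NumberTheory.LFunctions.SelbergOmega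

variable {τ : ℝ}

/-! ### A uniform majorant for the zero side on `t ∈ [u, u+h]` -/

/-- `1 + γ² ≤ 2 (1 + (γ − t)²)(1 + t²)`. [folklore] -/
theorem one_add_sq_le_two_mul (γ t : ℝ) : 1 + γ ^ 2 ≤ 2 * (1 + (γ - t) ^ 2) * (1 + t ^ 2) := by
  nlinarith [sq_nonneg (γ - 2 * t), sq_nonneg ((γ - t) * t - 1), sq_nonneg (γ - t), sq_nonneg t,
    mul_nonneg (sq_nonneg (γ - t)) (sq_nonneg t)]

/-- `(1 + (γ − t)²)⁻² ≤ 4(1 + t²)²/(1 + γ²)²`. [folklore] -/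
theorem inv_sq_shift_le (γ t : ℝ) : 1 / (1 + (γ - t) ^ 2) ^ 2 ≤ 4 * (1 + t ^ 2) ^ 2 / (1 + γ ^ 2) ^ 2 := by
  have h := one_add_sq_le_two_mul γ t
  have h1 : 0 < 1 + (γ - t) ^ 2 := by positivity
  have h2 : 0 < 1 + γ ^ 2 := by positivity
  rw [div_le_div_iff₀ (by positivity) (by positivity), one_mul]
  have : (1 + γ ^ 2) ^ 2 ≤ (2 * (1 + (γ - t) ^ 2) * (1 + t ^ 2)) ^ 2 := pow_le_pow_left₀ h2.le h 2
  nlinarith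

/-- The zero-side term `m(ρ) ĝ_τ(ρ − it)`, for `t` with `|t| ≤ B`, is at most
`m(ρ) · 4(1+B²)² W₂ /(1+γ²)²` (`W₂ = weilDecayW2 (1/2) g_τ`). [folklore] -/
theorem norm_zeroTerm_le (hτ : 0 < τ) {B t : ℝ} (ht : |t| ≤ B) {ρ : ℂ}
    (hρ : ρ ∈ ZetaZeros.riemannZetaNontrivialZeros) :
    ‖(riemannZetaZeroOrder ρ : ℂ) * weilMellin (gDil τ) (ρ - t * I)‖ ≤
      (riemannZetaZeroOrder ρ : ℝ) * (4 * (1 + B ^ 2) ^ 2 * weilDecayW2 (1 / 2) (gDil τ) / (1 + ρ.im ^ 2) ^ 2) := by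
  have hm : (0 : ℝ) ≤ riemannZetaZeroOrder ρ := by
    exact_mod_cast riemannZetaZeroOrder_nonneg (ZetaZeros.riemannZetaNontrivialZeros.ne_one hρ)
  rw [norm_mul, Complex.norm_intCast, abs_of_nonneg hm]
  refine mul_le_mul_of_nonneg_left ?_ hm
  have hre : |(ρ - t * I).re - 1 / 2| ≤ 1 / 2 := by
    have h0 := ZetaZeros.riemannZetaNontrivialZeros.re_pos hρ
    have h1 := ZetaZeros.riemannZetaNontrivialZeros.re_lt_one hρ
    simp only [sub_re, mul_re, ofReal_re, I_re, mul_zero, ofReal_im, I_im, mul_one, sub_self, sub_zero]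
    rw [abs_le]; constructor <;> linarith
  have h := norm_weilMellin_le_sq (gDil_isWeilTest hτ) hre
  have him : (ρ - t * I).im = ρ.im - t := by simp
  rw [him] at h
  refine h.trans ?_
  have hW : 0 ≤ weilDecayW2 (1 / 2) (gDil τ) := weilDecayW2_nonneg _ _
  have h2 := inv_sq_shift_le ρ.im t
  have hB : (1 + t ^ 2) ^ 2 ≤ (1 + B ^ 2) ^ 2 := by
    refine pow_le_pow_left₀ (by positivity) ?_ 2
    have : t ^ 2 ≤ B ^ 2 := by rw [← sq_abs t]; exact pow_le_pow_left₀ (abs_nonneg t) ht 2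
    linarith
  calc weilDecayW2 (1 / 2) (gDil τ) / (1 + (ρ.im - t) ^ 2) ^ 2
      = weilDecayW2 (1 / 2) (gDil τ) * (1 / (1 + (ρ.im - t) ^ 2) ^ 2) := by ring
    _ ≤ weilDecayW2 (1 / 2) (gDil τ) * (4 * (1 + t ^ 2) ^ 2 / (1 + ρ.im ^ 2) ^ 2) :=
        mul_le_mul_of_nonneg_left h2 hW
    _ ≤ weilDecayW2 (1 / 2) (gDil τ) * (4 * (1 + B ^ 2) ^ 2 / (1 + ρ.im ^ 2) ^ 2) := by
        gcongr
    _ = _ := by ring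

/-! ### Summing the zero side under the integral sign -/

/-- The zero side is continuous in `t` on bounded sets (uniform convergence). [folklore] -/
theorem continuousOn_zeroSide (hτ : 0 < τ) (B : ℝ) :
    ContinuousOn (fun t : ℝ => ∑' ρ : ZetaZeros.riemannZetaNontrivialZeros,
      (riemannZetaZeroOrder (ρ : ℂ) : ℂ) * weilMellin (gDil τ) ((ρ : ℂ) - t * I)) (Set.Icc (-B) B) := by
  refine continuousOn_tsum (u := fun ρ : ZetaZeros.riemannZetaNontrivialZeros =>
      (4 * (1 + B ^ 2) ^ 2 * weilDecayW2 (1 / 2) (gDil τ)) * weilZeroWeight (ρ : ℂ)) (fun ρ => ?_)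
    (weilZeroSummable.mul_left _) (fun ρ t ht => ?_)
  · refine (continuous_const.mul ((continuous_weilMellin (continuous_gDil τ) (gDil_isWeilTest hτ).2).comp
      (by fun_prop))).continuousOn
  · have h := norm_zeroTerm_le hτ (B := B) (abs_le.2 ⟨ht.1, ht.2⟩) ρ.2
    rw [weilZeroWeight]
    convert h using 1; ring

/-- **The zero side may be integrated termwise** over `t ∈ [u, u+h]`. [folklore] -/
theorem integral_zeroSide_eq_tsum (hτ : 0 < τ) (u h : ℝ) (hh : 0 ≤ h) :
    ∫ t in u..u + h, ∑' ρ : ZetaZeros.riemannZetaNontrivialZeros,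
        (riemannZetaZeroOrder (ρ : ℂ) : ℂ) * weilMellin (gDil τ) ((ρ : ℂ) - t * I) =
      ∑' ρ : ZetaZeros.riemannZetaNontrivialZeros, ∫ t in u..u + h,
        (riemannZetaZeroOrder (ρ : ℂ) : ℂ) * weilMellin (gDil τ) ((ρ : ℂ) - t * I) := by
  set B := |u| + h with hB
  set K : ℝ := 4 * (1 + B ^ 2) ^ 2 * weilDecayW2 (1 / 2) (gDil τ) with hK
  have hK0 : 0 ≤ K := by rw [hK]; have := weilDecayW2_nonneg (1 / 2) (gDil τ); positivity
  have htB : ∀ t ∈ Set.Ioc u (u + h), |t| ≤ B := by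
    intro t ht; rw [hB, abs_le]; constructor <;> cases abs_le.1 (le_refl |u|) <;>
      [skip; skip] <;> linarith [ht.1, ht.2, neg_abs_le u, le_abs_self u]
  simp_rw [intervalIntegral.integral_of_le (by linarith : u ≤ u + h)]
  refine integral_tsum (fun ρ => ?_) ?_
  · exact ((continuous_const.mul ((continuous_weilMellin (continuous_gDil τ) (gDil_isWeilTest hτ).2).comp
      (by fun_prop))).aestronglyMeasurable)
  · -- `∑ ∫⁻ ‖·‖ ≤ ∑ h K m(ρ)/(1+γ²)² < ∞`
    have hbound : ∀ ρ : ZetaZeros.riemannZetaNontrivialZeros,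
        ∫⁻ t in Set.Ioc u (u + h), ‖(riemannZetaZeroOrder (ρ : ℂ) : ℂ) * weilMellin (gDil τ) ((ρ : ℂ) - t * I)‖ₑ ≤
          ENNReal.ofReal (h * (K * weilZeroWeight (ρ : ℂ))) := by
      intro ρ
      have hle : ∀ t ∈ Set.Ioc u (u + h),
          ‖(riemannZetaZeroOrder (ρ : ℂ) : ℂ) * weilMellin (gDil τ) ((ρ : ℂ) - t * I)‖ₑ ≤
            ENNReal.ofReal (K * weilZeroWeight (ρ : ℂ)) := by
        intro t ht
        rw [← ofReal_norm]
        refine ENNReal.ofReal_le_ofReal ?_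
        have := norm_zeroTerm_le hτ (htB t ht) ρ.2
        rw [weilZeroWeight, hK]; convert this using 1; ring
      calc ∫⁻ t in Set.Ioc u (u + h), ‖(riemannZetaZeroOrder (ρ : ℂ) : ℂ) * weilMellin (gDil τ) ((ρ : ℂ) - t * I)‖ₑ
          ≤ ∫⁻ _ in Set.Ioc u (u + h), ENNReal.ofReal (K * weilZeroWeight (ρ : ℂ)) :=
            setLIntegral_mono measurable_const hle
        _ = ENNReal.ofReal (K * weilZeroWeight (ρ : ℂ)) * volume (Set.Ioc u (u + h)) := setLIntegral_const _ _
        _ = ENNReal.ofReal (h * (K * weilZeroWeight (ρ : ℂ))) := by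
            rw [Real.volume_Ioc, show u + h - u = h by ring, mul_comm, ← ENNReal.ofReal_mul hh]
    refine ne_top_of_le_ne_top ?_ (ENNReal.tsum_le_tsum hbound)
    have hs : Summable fun ρ : ZetaZeros.riemannZetaNontrivialZeros => h * (K * weilZeroWeight (ρ : ℂ)) :=
      (weilZeroSummable.mul_left K).mul_left h
    have hnn : ∀ ρ : ZetaZeros.riemannZetaNontrivialZeros, 0 ≤ h * (K * weilZeroWeight (ρ : ℂ)) := fun ρ =>
      mul_nonneg hh (mul_nonneg hK0 (weilZeroWeight_nonneg ρ.2))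
    rw [← ENNReal.ofReal_tsum_of_nonneg hnn hs]
    exact ENNReal.ofReal_ne_top

/-- Each zero contributes `∫_u^{u+h} K_τ(γ − t) dt + 𝒜_ρ(u+h) − 𝒜_ρ(u)`. [folklore] -/
theorem integral_zeroTerm (hτ : 0 < τ) (ρ : ℂ) (u h : ℝ) :
    ∫ t in u..u + h, (riemannZetaZeroOrder ρ : ℂ) * weilMellin (gDil τ) (ρ - t * I) =
      (riemannZetaZeroOrder ρ : ℂ) * ((∫ t in u..u + h, (kerDil τ (ρ.im - t) : ℂ)) +
        (offA τ ρ (u + h) - offA τ ρ u)) := by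
  rw [intervalIntegral.integral_const_mul]
  congr 1
  have hkey := integral_weilMellin_sub_kerDil hτ ρ u (u + h)
  have hc1 : IntervalIntegrable (fun t : ℝ => weilMellin (gDil τ) (ρ - t * I)) volume u (u + h) :=
    ((continuous_weilMellin (continuous_gDil τ) (gDil_isWeilTest hτ).2).comp (by fun_prop)).intervalIntegrable _ _
  have hc2 : IntervalIntegrable (fun t : ℝ => (kerDil τ (ρ.im - t) : ℂ)) volume u (u + h) :=
    (Complex.continuous_ofReal.comp ((continuous_kerDil τ).comp (by fun_prop))).intervalIntegrable _ _
  rw [intervalIntegral.integral_sub hc1 hc2] at hkey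
  linear_combination hkey

/-! ### The integrated explicit formula -/

/-- **The explicit formula for the window `[u, u+h]`** (`τ > 0`, `h ≥ 0`):
`∑_ρ m(ρ) {∫_u^{u+h} K_τ(γ−t) dt + 𝒜_ρ(u+h) − 𝒜_ρ(u)}`
`  = ∫_u^{u+h} (ĝ_τ(−it) + ĝ_τ(1−it)) dt − (𝒱_τ(u+h) − 𝒱_τ(u)) + ∫_u^{u+h} (1/π) ∫ K_τ(v−t) θ'(v) dv dt`.
[cite: Titchmarsh1986, §9.26] -/
theorem integrated_explicit_formula (hτ : 0 < τ) (u h : ℝ) (hh : 0 ≤ h) :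
    ∑' ρ : ZetaZeros.riemannZetaNontrivialZeros, (riemannZetaZeroOrder (ρ : ℂ) : ℂ) *
        ((∫ t in u..u + h, (kerDil τ ((ρ : ℂ).im - t) : ℂ)) + (offA τ ρ (u + h) - offA τ ρ u)) =
      (∫ t in u..u + h, (weilMellin (gDil τ) (-(t * I)) + weilMellin (gDil τ) (1 - t * I)))
        - (primeV τ (u + h) - primeV τ u)
        + ∫ t in u..u + h, ((((1 / π) * ∫ v : ℝ, kerDil τ (v - t) * riemannSiegelThetaDeriv v : ℝ)) : ℂ) := by
  -- pointwise explicit formula, integrated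
  have hEF : ∀ t : ℝ, ∑' ρ : ZetaZeros.riemannZetaNontrivialZeros,
      (riemannZetaZeroOrder (ρ : ℂ) : ℂ) * weilMellin (gDil τ) ((ρ : ℂ) - t * I) =
      weilMellin (gDil τ) (-(t * I)) + weilMellin (gDil τ) (1 - t * I) - primeTerm τ t +
        (((1 / π) * ∫ v : ℝ, kerDil τ (v - t) * riemannSiegelThetaDeriv v : ℝ) : ℂ) :=
    fun t => explicit_formula_testFn hτ t
  -- LHS
  have hL := integral_zeroSide_eq_tsum hτ u h hh
  simp_rw [integral_zeroTerm hτ] at hL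
  rw [← hL]
  -- continuity of the pieces on `[u, u+h]`
  have hcW : Continuous (weilMellin (gDil τ)) := continuous_weilMellin (continuous_gDil τ) (gDil_isWeilTest hτ).2
  have hpol : Continuous fun t : ℝ => weilMellin (gDil τ) (-(t * I)) + weilMellin (gDil τ) (1 - t * I) :=
    (hcW.comp (by fun_prop)).add (hcW.comp (by fun_prop))
  have hP : Continuous (primeTerm τ) := continuous_primeTerm τ
  -- the arch term is continuous on `[u, u+h]` because everything else is
  set B := |u| + |h| + 1 with hB
  have hZ := continuousOn_zeroSide hτ B
  have hsub : Set.uIcc u (u + h) ⊆ Set.Icc (-B) B := by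
    rw [Set.uIcc_of_le (by linarith)]
    intro t ht
    constructor <;> linarith [ht.1, ht.2, neg_abs_le u, le_abs_self u, le_abs_self h, neg_abs_le h, abs_nonneg h]
  have harch : ContinuousOn (fun t : ℝ =>
      ((((1 / π) * ∫ v : ℝ, kerDil τ (v - t) * riemannSiegelThetaDeriv v : ℝ)) : ℂ)) (Set.uIcc u (u + h)) := by
    have heq : ∀ t : ℝ, ((((1 / π) * ∫ v : ℝ, kerDil τ (v - t) * riemannSiegelThetaDeriv v : ℝ)) : ℂ) =
        (∑' ρ : ZetaZeros.riemannZetaNontrivialZeros,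
          (riemannZetaZeroOrder (ρ : ℂ) : ℂ) * weilMellin (gDil τ) ((ρ : ℂ) - t * I)) -
        (weilMellin (gDil τ) (-(t * I)) + weilMellin (gDil τ) (1 - t * I)) + primeTerm τ t := by
      intro t; rw [hEF t]; ring
    simp_rw [heq]
    exact ((hZ.mono hsub).sub hpol.continuousOn).add hP.continuousOn
  have hIZ : IntervalIntegrable (fun t : ℝ => ∑' ρ : ZetaZeros.riemannZetaNontrivialZeros,
      (riemannZetaZeroOrder (ρ : ℂ) : ℂ) * weilMellin (gDil τ) ((ρ : ℂ) - t * I)) volume u (u + h) :=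
    (hZ.mono hsub).intervalIntegrable
  have hIpol := hpol.intervalIntegrable (μ := volume) u (u + h)
  have hIP := hP.intervalIntegrable (μ := volume) u (u + h)
  have hIarch := harch.intervalIntegrable (μ := volume)
  -- integrate the pointwise identity
  have hint : ∫ t in u..u + h, ∑' ρ : ZetaZeros.riemannZetaNontrivialZeros,
      (riemannZetaZeroOrder (ρ : ℂ) : ℂ) * weilMellin (gDil τ) ((ρ : ℂ) - t * I) =
      ∫ t in u..u + h, ((weilMellin (gDil τ) (-(t * I)) + weilMellin (gDil τ) (1 - t * I)) - primeTerm τ t +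
        ((((1 / π) * ∫ v : ℝ, kerDil τ (v - t) * riemannSiegelThetaDeriv v : ℝ)) : ℂ)) :=
    intervalIntegral.integral_congr fun t _ => hEF t
  rw [hint, intervalIntegral.integral_add (hIpol.sub hIP) hIarch, intervalIntegral.integral_sub hIpol hIP,
    integral_primeTerm]

end Literature.NumberTheory.LFunctions.SelbergDelta
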